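import Literature.Combinatorics.Designs.MannSubsquareObstruction

/-!
# MOLS(10) floor fact in the kernel: a 10 × 10 Latin square with a 5 × 5 subsquare has no orthogonal mate
Framing: lottery ticket; floor = certified bounds/negative ranges.

Cell `pub-namedobj`, target M (three MOLS of order 10). Instances of Mann's theorem (Literature
`MannSubsquareObstruction`, `no_orthogonal_mate_of_subsquare`: order `2m`, `m` odd, subsquare of order `m`) at the
census order `10` (`m = 5`) and at order `6` (`m = 3`). Printed floor fact (Mann 1944; Bright–Keita–Stevens 2026 §1);
kernel replication, no novelty claim. Consequence for the census: no square of a pair — a fortiori of a triple — of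
MOLS(10) contains a Latin subsquare of order 5. No `sorry`, no new axioms.
-/

namespace Summit.Ventures.DiscreteObjects.MOLS

open Literature.Combinatorics.Designs.LatinSquares

/-- **Order 10.** A Latin square of order 10 (on `Fin 10`) with a `5 × 5` subarray `R × C` whose entries lie in a
5-set `S` of symbols (a subsquare of order 5) has no orthogonal mate. -/
theorem no_orthogonal_mate_of_subsquare_five (L M : Fin 10 → Fin 10 → Fin 10) (hL : IsLatinSquare L)
    (hM : IsLatinSquare M) (R C S : Finset (Fin 10)) (hR : R.card = 5) (hC : C.card = 5) (hS : S.card = 5)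
    (hsub : ∀ i ∈ R, ∀ j ∈ C, L i j ∈ S) : ¬ IsOrthogonalMate L M := fun hLM =>
  no_orthogonal_mate_of_subsquare hL hM hLM hR hC hS hsub (by simp) ⟨2, rfl⟩

/-- **Order 6.** A Latin square of order 6 with a subsquare of order 3 has no orthogonal mate (a special case of
Tarry's theorem, here by Mann's argument). -/
theorem no_orthogonal_mate_of_subsquare_three (L M : Fin 6 → Fin 6 → Fin 6) (hL : IsLatinSquare L)
    (hM : IsLatinSquare M) (R C S : Finset (Fin 6)) (hR : R.card = 3) (hC : C.card = 3) (hS : S.card = 3)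
    (hsub : ∀ i ∈ R, ∀ j ∈ C, L i j ∈ S) : ¬ IsOrthogonalMate L M := fun hLM =>
  no_orthogonal_mate_of_subsquare hL hM hLM hR hC hS hsub (by simp) ⟨1, rfl⟩

end Summit.Ventures.DiscreteObjects.MOLS
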